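import Summits.QuantumFields.YangMills.Theorems.UnitScaleTiltHistoryTailBoundedHeight
import Summits.QuantumFields.YangMills.Theorems.UnitScaleTiltHistoryTailPerPlaquetteV3b
import Summits.QuantumFields.YangMills.Theorems.UnitScaleTiltHistoryTailStubBudget
import Summits.QuantumFields.YangMills.Theorems.UnitScaleTiltHistoryTailChessboardT3
import Summits.QuantumFields.YangMills.Theses.UnitScaleTilt
import HarnessLib

/-!
# Birth skeleton v5q for the ERRATUM-v3′ crux `UnitScaleTilt.HistoryTailL` (stmt-QuantumFields-19936) — OWNER cut (ym3-torus-plan g17, RULING g17-№4)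

`HistoryTailL := ∀ L b₁ p₁, ∃ (b₀, p₀) ⪰ (b₁, p₁), 0 < b₀ ∧ 2 < p₀ ∧ ∀ m > 0, ∃ γ₁ > 0, ∀ F (F.L = L) γ ≤ γ₁, HistoryTailAt F γ b₀ p₀ m`.

WHY v5q (RULING g17-№4, 2026-08-27, after ★ym-ust-18916-p1 g3's located finding F-g3-2): both v5p′ cuts (g3's b2c4959da412966e, owner's 606226de19384dd0)
typed the large-field half against ★alpha-1's CONCRETE datum `OfV2At.dataT3c`, whose trivial-history weight is FLOORED `≥ 1` at EVERY field
(`AlphaInputsT3AC.OfV2At.lfDataT3c_one_le_wt_trivReg`) instead of print's windowed characteristic function χ_k ((40)–(41) p.266).  Consequences: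
g3's STUB 2″(e) «a.e. `wt ≠ 0 → Adm`» is FALSE at `r = triv` for that datum (it would make a.e. field `(40)`-small), hence {2′, 2″} is an inconsistent
stub set; and the owner's merged numerator bound `∫_{E_S} up ≤ e^{−p²|S|/4 + CxN³}·∫low` is unprovable from the record (the trivial term is
uncontrolled off the (40)-window: r1/r2 are `Adm`-guarded).  A registered stub must be a TRUE statement over today's declarations, so v5q states the
large-field half DATUM-FREE, about the true Wilson–Gibbs measure («WHAT, not HOW»); the (α)-interface (lane records, the WINDOWED twin datum
`dataT3cW`, Mechanism A, g3's 4c/4a/4b and 2″(a)–(d)) is the LINE by which STUB A gets proved once ★alpha-1 lands the windowed twin with its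
`Ineq41AE` (alpha-1's own design note at `AlphaInputsT3ACv2.avgWindowFactor`).

TWO REGISTERED STUBS (sorries only in §1):
* STUB A `stub_jointRateHigh` (XL) — the JOINT large-plaquette bound for SEPARATED families under the level-`K` Gibbs measure, odd `L ≥ 7`: one
  profile `(r₀, b₀, p₀)` and constants `ccol, C, γ₁ ≤ 1` per `L`, a height floor `j₀` per family, then for every `ccol·x_j^{r₀}`-separated family `S`
  of level-`j` plaquettes `Gibbs_K(∀ q ∈ S, θBal(K−j) ≤ |Ū^j(∂q) − 1|) ≤ exp(−p_j²/4·|S| + C·x_j·N_j³)` — [Balaban1985UV3] Thm 1 (5) p.256 with the support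
  (40)–(41) p.266 and the small factors (70)–(71) p.273, integrated; the volume slack `e^{C x N³}` is the vacuum-energy ∕ lower-envelope bookkeeping
  that reflection positivity removes in §2 (this is exactly the inequality `hB` the v5p′ composition consumed, with the datum eliminated);
* STUB B `stub_perPlaquetteSmallBlocks` — v5p STUB 5 VERBATIM (odd `L < 7` residue, owner ruling g16-№1 (B)).
NOT stubs: the chessboard (LANDED `HistoryTailChessboardT3.chessboardRP_T3`, p481363); the lane records ∕ datum (the HOW of STUB A, see above).

§2 (sorry-free): v5p's |S|-th-root and exponent bookkeeping verbatim; v4's `perPlaquetteHighRaw` text as a THEOREM (chessboard + STUB A); v5p's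
budget ∕ split ∕ tail chain to `HistoryTailAt` at one profile for every `m` (K2′ shape); the PROFILE MONOTONICITY of `HistoryTailAt` (ym-vet-19936,
ym-cruxidea-18916-2 `IdeaMonoLift`: `θBal` ↑ in `(b₀, p₀)` for `γ ≤ 1` ⇒ `histGood` ↑ ⇒ bad events ↓) upgrading one profile per `L` to «above every
threshold»; `HistoryTailL_of` BY NAME.
-/

noncomputable section

namespace Summit.QuantumFields.YangMills.Cruxes.HistoryTailL.BirthV5q

open MeasureTheory
open Literature.MathematicalPhysics.QuantumFieldTheory.Balaban1983to89
open Literature.MathematicalPhysics.QuantumFieldTheory.Balaban1983to89.T3ContinuumYM3Torus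
open Literature.MathematicalPhysics.QuantumFieldTheory.Balaban1983to89.T3UnitScaleTilt
open Literature.MathematicalPhysics.QuantumFieldTheory.Balaban1983to89.T3UnitLawDensityEML
open Literature.MathematicalPhysics.QuantumFieldTheory.Balaban1983to89.T3CruxEstimates
open Literature.MathematicalPhysics.QuantumFieldTheory.Balaban1983to89.T3BareTailProfile
open Literature.MathematicalPhysics.QuantumFieldTheory.Balaban1983to89.T3Thresholds
open Literature.MathematicalPhysics.QuantumFieldTheory.Balaban1983to89.T3ThresholdSmallness (sqrt_coupling_pos_le)
open Summit.QuantumFields.YangMills.Theorems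
open Summit.QuantumFields.YangMills.Theorems.HistoryTailChessboardT3 (chessboardRP_T3)

/-! ## §1 The registered stubs (the ONLY sorries of the file) -/

/-- STUB A (XL; IN PRINT: [Balaban1985UV3] Thm 1 (5) p.256 «χ_k exp[−(1/g_k²)A^η(U_k) − c|T₁^{(k)}|] ≤ ρ_k ≤ exp O(1)|T₁^{(k)}|» read through the
inductive representation (38)–(41) p.266 — the support of the characteristic functions (40) and the small factors (70)–(71) p.273 of the large-field
regions — for a PRESCRIBED dilute family of large plaquettes) — **THE JOINT LARGE-PLAQUETTE BOUND FOR SEPARATED FAMILIES UNDER THE GIBBS MEASURE,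
LARGE BLOCKS (odd `L ≥ 7`)**: per block size one profile `(r₀, b₀, p₀)` (`p₀ > 1 + 3r₀/2`, print's `p₀ = 2r₀ + 1`) and constants `ccol ≥ 1` (collar
multiple), `C ≥ 0` (volume slack), `0 < γ₁ ≤ 1`; per family and coupling a height floor `j₀`; then for all heights `j₀ < j ≤ K` and every family `S` of
level-`j` plaquettes pairwise `ccol·(1 + log g_j⁻¹)^{r₀}` apart (`g_j² = γL^{−(K−j)}`), the Gibbs mass of «every plaquette of `S` of the `j`-fold
block average is `θBal(K−j)`-large» is at most `exp(−p_j²/4·|S| + C·(1 + log g_j⁻¹)·N_j³)`, `N_j = sitesPerDir j`.  No datum, no weights, no lower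
envelope: a statement about the lattice Yang–Mills measure itself (the (α)-lane's windowed twin datum + Mechanism A is the intended PROOF, RULING g17-№4).
Separation in the chessboard's own currency `Site.tdist q.src q'.src` (LANDED `chessboardRP_T3`). [cite: Balaban1985UV3, (5) p.256, (40)-(41) p.266 and (70)-(71) p.273] -/
theorem stub_jointRateHigh :
    ∀ (L : ℕ), Odd L → 7 ≤ L →
      ∃ r₀ b₀ p₀ ccol C γ₁ : ℝ, 0 ≤ r₀ ∧ 0 < b₀ ∧ 2 < p₀ ∧ 1 + 3 * r₀ / 2 < p₀ ∧ 1 ≤ ccol ∧ 0 ≤ C ∧ 0 < γ₁ ∧ γ₁ ≤ 1 ∧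
        ∀ (F : T3Family) (γ : ℝ), F.L = L → 0 < γ → γ ≤ γ₁ →
          ∃ j₀ : ℕ, ∀ (K j : ℕ), j₀ < j → j ≤ K → ∀ S : Finset (Plaq (F.P K) j),
            (∀ q ∈ S, ∀ q' ∈ S, q ≠ q' →
              ccol * (1 + Real.log (Real.sqrt (γ * ((F.L : ℝ)⁻¹) ^ (K - j)))⁻¹) ^ r₀ ≤ (Site.tdist q.src q'.src : ℝ)) →
            (gibbsK F ℰp γ K).real
                {U | ∀ q ∈ S, θBal F.L γ b₀ p₀ (K - j) ≤
                  GaugeGroup.dist1 (GaugeField.plaqHol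
                    (Averaging.iter (fun _ => BlockAveraging.blockAvg ℰp) j U) q)} ≤
              Real.exp (-(B10.pFun b₀ p₀ (Real.sqrt (γ * ((F.L : ℝ)⁻¹) ^ (K - j))) ^ 2 / 4) * (S.card : ℝ) +
                C * (1 + Real.log (Real.sqrt (γ * ((F.L : ℝ)⁻¹) ^ (K - j)))⁻¹) * ((F.P K).sitesPerDir j : ℝ) ^ 3) := by
  sorry


/-- STUB B (= v5p STUB 5 VERBATIM; RESIDUE, rank-last; OWNER RULING g16-№1 (B): the SMALL-BLOCK RANGE odd `L < 7`, i.e. `L ∈ {3, 5}`) — v4's registered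
`stub_perPlaquetteHighRaw` body VERBATIM, restricted to the block sizes at which OUR typed socket's lower representation `RepAtHeights`
(window `PlaqSmall (θBal n) V` on the data at every height) is inconsistent on the window's edge band (★19201-p1 FINDING #44→#56:
κ_min^{lin}(L)·√L = 1.66 / 1.08 at L = 3 / 5; print carries χ on the MINIMISER, CMP 102 p.265).  The residue line re-types the lower
representation (R1: χ on the minimiser + an edge-band clause, or R2′: a shrunken window, + R0 height guard) in SUCCESSOR modules; not staffed
before the large-L chain (STUBS 1–4) closes.  NOT a printed floor: CMP 95–102 are letter (A) «L = 2 or 3».  (Text = v5r STUB 5 verbatim.)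
[cite: Balaban1985UV3, (41) p.266, (47) p.267 and (71) p.273] -/
theorem stub_perPlaquetteSmallBlocks :
    ∀ (L : ℕ), Odd L → 1 < L → L < 7 →
      ∃ r₀ κ b₀ p₀ γ₁ : ℝ, 0 ≤ r₀ ∧ 0 ≤ κ ∧ 0 < b₀ ∧ 2 < p₀ ∧ 1 + 3 * r₀ / 2 < p₀ ∧ 0 < γ₁ ∧ γ₁ ≤ 1 ∧
        ∀ (F : T3Family) (γ : ℝ), F.L = L → 0 < γ → γ ≤ γ₁ →
          ∃ (j₀ : ℕ) (C : ℝ) (A : ℕ), 0 ≤ C ∧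
            ∀ (K j : ℕ), j₀ < j → j ≤ K → ∀ p : Plaq (F.P K) j,
              (gibbsK F ℰp γ K).real
                  {U | θBal F.L γ b₀ p₀ (K - j) ≤
                    GaugeGroup.dist1 (GaugeField.plaqHol
                      (Averaging.iter (fun _ => BlockAveraging.blockAvg ℰp) j U) p)} ≤
                C * (F.scheme ℰp γ).β (K - j) ^ A *
                  Real.exp (-(B10.pFun b₀ p₀ (Real.sqrt (γ * ((F.L : ℝ)⁻¹) ^ (K - j))) ^ 2 / 4) +
                    κ * (1 + Real.log (Real.sqrt (γ * ((F.L : ℝ)⁻¹) ^ (K - j)))⁻¹) ^ (2 + 3 * r₀)) := by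
  sorry

/-! ## §2 The composition — NO sorry below this line -/

/-- **THE |S|-TH ROOT ARITHMETIC**: `a ≤ b^{1/n}`, `b ≤ CRm·e^{E}`, `n ≥ 1` ⇒ `a ≤ max(1, CRm)·e^{E/n}`. [folklore] -/
theorem root_bound {a b CRm E : ℝ} {n : ℕ} (hn : 1 ≤ n) (hb0 : 0 ≤ b) (hCRm : 0 ≤ CRm)
    (hab : a ≤ b ^ ((1 : ℝ) / (n : ℝ))) (hb : b ≤ CRm * Real.exp E) : a ≤ max 1 CRm * Real.exp (E / n) := by
  have hn0 : (0 : ℝ) < n := by exact_mod_cast hn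
  have hexp : 0 ≤ (1 : ℝ) / (n : ℝ) := by positivity
  have h1 : b ^ ((1 : ℝ) / (n : ℝ)) ≤ (CRm * Real.exp E) ^ ((1 : ℝ) / (n : ℝ)) := Real.rpow_le_rpow hb0 hb hexp
  have h2 : (CRm * Real.exp E) ^ ((1 : ℝ) / (n : ℝ)) = CRm ^ ((1 : ℝ) / (n : ℝ)) * Real.exp (E / n) := by
    rw [Real.mul_rpow hCRm (Real.exp_pos _).le, ← Real.exp_mul]
    congr 2
    field_simp
  have h3 : CRm ^ ((1 : ℝ) / (n : ℝ)) ≤ max 1 CRm := by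
    by_cases hC1 : CRm ≤ 1
    · exact (Real.rpow_le_one hCRm hC1 hexp).trans (le_max_left _ _)
    · have hC1' : 1 ≤ CRm := (not_le.mp hC1).le
      have hle : (1 : ℝ) / (n : ℝ) ≤ 1 := by
        rw [div_le_one hn0]; exact_mod_cast hn
      calc CRm ^ ((1 : ℝ) / (n : ℝ)) ≤ CRm ^ (1 : ℝ) := Real.rpow_le_rpow_of_exponent_le hC1' hle
        _ = CRm := Real.rpow_one _
        _ ≤ max 1 CRm := le_max_right _ _
  calc a ≤ b ^ ((1 : ℝ) / (n : ℝ)) := hab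
    _ ≤ CRm ^ ((1 : ℝ) / (n : ℝ)) * Real.exp (E / n) := h1.trans_eq h2
    _ ≤ max 1 CRm * Real.exp (E / n) := mul_le_mul_of_nonneg_right h3 (Real.exp_nonneg _)

/-- **THE EXPONENT BOOKKEEPING**: with `x ≥ 1`, `ρ = ccol·x^{r₀}` (`ccol ≥ 1`, `r₀ ≥ 0`), `T ≤ n·8(L(ρ+4))³` and `C ≥ 0`:
`(−¼P·n + C·x·T)/n ≤ −¼P + κ·x^{2+3r₀}` with `κ = 8CL³(ccol+4)³`. [folklore] -/
theorem exponent_bound {P4 C x L ccol r₀ T : ℝ} {n : ℕ} (hn : 1 ≤ n) (hC : 0 ≤ C) (hx : 1 ≤ x) (hL : 0 ≤ L)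
    (hccol : 1 ≤ ccol) (hr₀ : 0 ≤ r₀) (hT : T ≤ (n : ℝ) * (8 * (L * (ccol * x ^ r₀ + 4)) ^ 3)) :
    (-P4 * (n : ℝ) + C * x * T) / n ≤ -P4 + 8 * C * L ^ 3 * (ccol + 4) ^ 3 * x ^ (2 + 3 * r₀) := by
  have hn0 : (0 : ℝ) < n := by exact_mod_cast hn
  have hx0 : 0 < x := lt_of_lt_of_le one_pos hx
  have hxr : 1 ≤ x ^ r₀ := Real.one_le_rpow hx hr₀
  have hxr0 : 0 ≤ x ^ r₀ := le_trans zero_le_one hxr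
  -- `(ρ + 4) ≤ (ccol + 4)·x^{r₀}`
  have hρ : ccol * x ^ r₀ + 4 ≤ (ccol + 4) * x ^ r₀ := by nlinarith
  have hρ0 : 0 ≤ ccol * x ^ r₀ + 4 := by positivity
  have hcube : (L * (ccol * x ^ r₀ + 4)) ^ 3 ≤ (L * ((ccol + 4) * x ^ r₀)) ^ 3 :=
    pow_le_pow_left₀ (mul_nonneg hL hρ0) (mul_le_mul_of_nonneg_left hρ hL) 3
  -- `x · (x^{r₀})³ = x^{1+3r₀} ≤ x^{2+3r₀}`
  have hpow3 : (x ^ r₀) ^ 3 = x ^ (3 * r₀) := by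
    rw [← Real.rpow_natCast, ← Real.rpow_mul hx0.le]; norm_num; ring_nf
  have hx13 : x * x ^ (3 * r₀) = x ^ (1 + 3 * r₀) := by
    rw [Real.rpow_add hx0, Real.rpow_one]
  have hx23 : x ^ (1 + 3 * r₀) ≤ x ^ (2 + 3 * r₀) := Real.rpow_le_rpow_of_exponent_le hx (by linarith)
  -- divide
  have hdiv : (-P4 * (n : ℝ) + C * x * T) / n = -P4 + C * x * (T / n) := by
    field_simp
  rw [hdiv]
  have hTn : T / n ≤ 8 * (L * (ccol * x ^ r₀ + 4)) ^ 3 := by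
    rw [div_le_iff₀ hn0]; linarith
  have hCx : 0 ≤ C * x := mul_nonneg hC hx0.le
  calc -P4 + C * x * (T / n) ≤ -P4 + C * x * (8 * (L * ((ccol + 4) * x ^ r₀)) ^ 3) := by
        have := mul_le_mul_of_nonneg_left (hTn.trans (mul_le_mul_of_nonneg_left hcube (by norm_num))) hCx
        linarith
    _ = -P4 + 8 * C * L ^ 3 * (ccol + 4) ^ 3 * (x * (x ^ r₀) ^ 3) := by ring
    _ = -P4 + 8 * C * L ^ 3 * (ccol + 4) ^ 3 * x ^ (1 + 3 * r₀) := by rw [hpow3, hx13]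
    _ ≤ -P4 + 8 * C * L ^ 3 * (ccol + 4) ^ 3 * x ^ (2 + 3 * r₀) := by
        have hk : 0 ≤ 8 * C * L ^ 3 * (ccol + 4) ^ 3 := by positivity
        have := mul_le_mul_of_nonneg_left hx23 hk
        linarith

/-- **v4's PER-PLAQUETTE RATE AS A THEOREM** (text = v4's registered `stub_perPlaquetteHighRaw` VERBATIM): large blocks from STUB A by reflection
positivity — the LANDED chessboard `chessboardRP_T3` (p481363) gives, for every level-`j` plaquette `p`, a `ccol·x^{r₀}`-separated reflection family `S ∋ p`
with `Gibbs(E_p) ≤ Gibbs(⋂_{q∈S} E_q)^{1/|S|}` and `N_j³ ≤ |S|·(8(L(ρ+4)))³`; STUB A bounds the joint event; the `|S|`-th root (`root_bound`) and the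
exponent bookkeeping (`exponent_bound`) turn `−p²/4·|S| + C x N³` into `−p²/4 + κ·x^{2+3r₀}` with `κ = 8CL³(ccol+4)³`; small blocks = STUB B.
[cite: Balaban1985UV3, (5) p.256 and (70)-(71) p.273] -/
theorem perPlaquetteHighRaw :
    ∀ (L : ℕ), Odd L → 1 < L →
      ∃ r₀ κ b₀ p₀ γ₁ : ℝ, 0 ≤ r₀ ∧ 0 ≤ κ ∧ 0 < b₀ ∧ 2 < p₀ ∧ 1 + 3 * r₀ / 2 < p₀ ∧ 0 < γ₁ ∧ γ₁ ≤ 1 ∧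
        ∀ (F : T3Family) (γ : ℝ), F.L = L → 0 < γ → γ ≤ γ₁ →
          ∃ (j₀ : ℕ) (C : ℝ) (A : ℕ), 0 ≤ C ∧
            ∀ (K j : ℕ), j₀ < j → j ≤ K → ∀ p : Plaq (F.P K) j,
              (gibbsK F ℰp γ K).real
                  {U | θBal F.L γ b₀ p₀ (K - j) ≤
                    GaugeGroup.dist1 (GaugeField.plaqHol
                      (Averaging.iter (fun _ => BlockAveraging.blockAvg ℰp) j U) p)} ≤
                C * (F.scheme ℰp γ).β (K - j) ^ A *
                  Real.exp (-(B10.pFun b₀ p₀ (Real.sqrt (γ * ((F.L : ℝ)⁻¹) ^ (K - j))) ^ 2 / 4) +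
                    κ * (1 + Real.log (Real.sqrt (γ * ((F.L : ℝ)⁻¹) ^ (K - j)))⁻¹) ^ (2 + 3 * r₀)) := by
  intro L hLo hL
  by_cases h7 : 7 ≤ L
  swap
  · exact stub_perPlaquetteSmallBlocks L hLo hL (not_le.mp h7)
  obtain ⟨r₀, b₀, p₀, ccol, C, γ₁, hr₀, hb, hp2, hp, hccol, hC, hγ₁, hγ₁1, hG⟩ := stub_jointRateHigh L hLo h7
  have hL0 : (0 : ℝ) ≤ (L : ℝ) := by positivity
  refine ⟨r₀, 8 * C * (L : ℝ) ^ 3 * (ccol + 4) ^ 3, b₀, p₀, γ₁, hr₀, by positivity, hb, hp2, hp, hγ₁, hγ₁1,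
    fun F γ hFL hγ hle => ?_⟩
  have hγ1 : γ ≤ 1 := hle.trans hγ₁1
  obtain ⟨j₀, hGF⟩ := hG F γ hFL hγ hle
  subst hFL
  have hL1 : 1 ≤ F.L := F.hL.2.le
  refine ⟨j₀, 1, 0, zero_le_one, fun K j hj hjK p => ?_⟩
  -- names for the scale-`K−j` quantities
  set g : ℝ := Real.sqrt (γ * ((F.L : ℝ)⁻¹) ^ (K - j)) with hg
  set x : ℝ := 1 + Real.log g⁻¹ with hx
  set θ : ℝ := θBal F.L γ b₀ p₀ (K - j) with hθ
  have hgpos : 0 < g := (sqrt_coupling_pos_le hL1 hγ (K - j)).1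
  have hg1 : g ≤ 1 := coupling_le_one hL1 hγ hγ1 (K - j)
  have hx1 : 1 ≤ x := by
    have : 0 ≤ Real.log g⁻¹ := Real.log_nonneg (one_le_inv_iff₀.mpr ⟨hgpos, hg1⟩)
    linarith
  have hxr : 1 ≤ x ^ r₀ := Real.one_le_rpow hx1 hr₀
  -- the chessboard family at separation `ρ = ccol·x^{r₀}` (LANDED p481363)
  have hρ1 : 1 ≤ ccol * x ^ r₀ := by nlinarith
  obtain ⟨S, hpS, hsep, hcount, hchess⟩ :=
    chessboardRP_T3 F.L hLo hL F γ rfl hγ hγ1 θ K j hjK (ccol * x ^ r₀) hρ1 p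
  have hcard : 1 ≤ S.card := Finset.card_pos.mpr ⟨p, hpS⟩
  -- STUB A on the family
  have hB : (gibbsK F ℰp γ K).real
        {U | ∀ q ∈ S, θ ≤ GaugeGroup.dist1 (GaugeField.plaqHol
          (Averaging.iter (fun _ => BlockAveraging.blockAvg ℰp) j U) q)} ≤
      1 * Real.exp (-(B10.pFun b₀ p₀ g ^ 2 / 4) * (S.card : ℝ) + C * x * ((F.P K).sitesPerDir j : ℝ) ^ 3) := by
    rw [one_mul]; exact hGF K j hj hjK S hsep
  -- the root and the exponent
  have hroot := root_bound (E := -(B10.pFun b₀ p₀ g ^ 2 / 4) * (S.card : ℝ) + C * x * ((F.P K).sitesPerDir j : ℝ) ^ 3)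
    hcard measureReal_nonneg zero_le_one hchess hB
  have hexp := exponent_bound (P4 := B10.pFun b₀ p₀ g ^ 2 / 4) hcard hC hx1 hL0 hccol hr₀ hcount
  have hfinal : max 1 (1 : ℝ) * Real.exp ((-(B10.pFun b₀ p₀ g ^ 2 / 4) * (S.card : ℝ) +
        C * x * ((F.P K).sitesPerDir j : ℝ) ^ 3) / S.card) ≤
      max 1 (1 : ℝ) * Real.exp (-(B10.pFun b₀ p₀ g ^ 2 / 4) + 8 * C * (F.L : ℝ) ^ 3 * (ccol + 4) ^ 3 * x ^ (2 + 3 * r₀)) :=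
    mul_le_mul_of_nonneg_left (Real.exp_le_exp.mpr hexp) (le_trans zero_le_one (le_max_left _ _))
  calc (gibbsK F ℰp γ K).real
          {U | θ ≤ GaugeGroup.dist1 (GaugeField.plaqHol (Averaging.iter (fun _ => BlockAveraging.blockAvg ℰp) j U) p)}
        ≤ max 1 (1 : ℝ) * Real.exp (-(B10.pFun b₀ p₀ g ^ 2 / 4) + 8 * C * (F.L : ℝ) ^ 3 * (ccol + 4) ^ 3 * x ^ (2 + 3 * r₀)) :=
          hroot.trans hfinal
    _ = 1 * (F.scheme ℰp γ).β (K - j) ^ 0 *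
          Real.exp (-(B10.pFun b₀ p₀ g ^ 2 / 4) + 8 * C * (F.L : ℝ) ^ 3 * (ccol + 4) ^ 3 * x ^ (2 + 3 * r₀)) := by
          rw [max_self, pow_zero, mul_one]


/-- **K2′ AT ONE PROFILE PER BLOCK SIZE** (v5p's `HistoryTail_of` chain — LANDED `HistoryTailBirthV4.stub_budget` p442213, `HistoryTailBoundedHeight.perPlaquette_of_split`
p438760, `HistoryTailBirthV3b.stub_tailOfPerPlaquette` p432346, `historyTailAt_of_averagedTailAt` — run from `perPlaquetteHighRaw`, whose profile and `γ₁` do not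
depend on `m`): for odd `L > 1` ONE profile `(b₀, p₀)` and one `γ₁ ≤ 1` serve `HistoryTailAt F γ b₀ p₀ m` for EVERY `m > 0`. [cite: Balaban1985UV3, (71) p.273] -/
theorem historyTailAt_oneProfile :
    ∀ (L : ℕ), Odd L → 1 < L → ∃ b₀ p₀ γ₁ : ℝ, 0 < b₀ ∧ 2 < p₀ ∧ 0 < γ₁ ∧ γ₁ ≤ 1 ∧
      ∀ (m : ℕ), 0 < m → ∀ (F : T3Family) (γ : ℝ), F.L = L → 0 < γ → γ ≤ γ₁ → HistoryTailAt F γ b₀ p₀ m := by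
  intro L hLo hL
  obtain ⟨r₀, κ, b₀, p₀, γ₁, hr₀, hκ, hb, hp2, hp, hγ₁, hγ₁1, h⟩ := perPlaquetteHighRaw L hLo hL
  obtain ⟨C₆, c, hC₆, hc, hbud⟩ := HistoryTailBirthV4.stub_budget b₀ p₀ r₀ κ hb hr₀ hκ hp
  refine ⟨b₀, p₀, γ₁, hb, hp2, hγ₁, hγ₁1, fun m hm F γ hFL hγ hle => ?_⟩
  have hγ1 : γ ≤ 1 := hle.trans hγ₁1
  have hp1 : (1 : ℝ) ≤ p₀ := by linarith
  have hL1 : 1 ≤ F.L := F.hL.2.le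
  obtain ⟨j₀, C, A, hC, hhigh⟩ := h F γ hFL hγ hle
  have hhigh' : ∃ (C : ℝ) (A : ℕ) (c : ℝ), 0 ≤ C ∧ 0 < c ∧
      ∀ (K j : ℕ), j₀ < j → j ≤ K → ∀ p : Plaq (F.P K) j,
        (gibbsK F ℰp γ K).real
            {U | θBal F.L γ b₀ p₀ (K - j) ≤
              GaugeGroup.dist1 (GaugeField.plaqHol
                (Averaging.iter (fun _ => BlockAveraging.blockAvg ℰp) j U) p)} ≤
          C * (F.scheme ℰp γ).β (K - j) ^ A *
            Real.exp (-(c * B10.pFun b₀ p₀ (Real.sqrt (γ * ((F.L : ℝ)⁻¹) ^ (K - j))) ^ 2)) := by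
    refine ⟨C * C₆, A, c, mul_nonneg hC hC₆, hc, fun K j hj hjK p => ?_⟩
    have hg := sqrt_coupling_pos_le hL1 hγ (K - j)
    have hg1 := coupling_le_one hL1 hγ hγ1 (K - j)
    have hβA : 0 ≤ C * (F.scheme ℰp γ).β (K - j) ^ A :=
      mul_nonneg hC (pow_nonneg (F.scheme_β_nonneg ℰp hγ.le (K - j)) A)
    calc (gibbsK F ℰp γ K).real
            {U | θBal F.L γ b₀ p₀ (K - j) ≤
              GaugeGroup.dist1 (GaugeField.plaqHol
                (Averaging.iter (fun _ => BlockAveraging.blockAvg ℰp) j U) p)}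
          ≤ C * (F.scheme ℰp γ).β (K - j) ^ A *
              Real.exp (-(B10.pFun b₀ p₀ (Real.sqrt (γ * ((F.L : ℝ)⁻¹) ^ (K - j))) ^ 2 / 4) +
                κ * (1 + Real.log (Real.sqrt (γ * ((F.L : ℝ)⁻¹) ^ (K - j)))⁻¹) ^ (2 + 3 * r₀)) := hhigh K j hj hjK p
      _ ≤ C * (F.scheme ℰp γ).β (K - j) ^ A *
              (C₆ * Real.exp (-(c * B10.pFun b₀ p₀ (Real.sqrt (γ * ((F.L : ℝ)⁻¹) ^ (K - j))) ^ 2))) :=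
            mul_le_mul_of_nonneg_left (hbud _ hg.1 hg1) hβA
      _ = C * C₆ * (F.scheme ℰp γ).β (K - j) ^ A *
              Real.exp (-(c * B10.pFun b₀ p₀ (Real.sqrt (γ * ((F.L : ℝ)⁻¹) ^ (K - j))) ^ 2)) := by ring
  have hPP := HistoryTailBoundedHeight.perPlaquette_of_split j₀ F hγ hγ1 hb.le p₀ hhigh'
  exact historyTailAt_of_averagedTailAt F hγ hγ1 hb hp1 hm
    (HistoryTailBirthV3b.stub_tailOfPerPlaquette F γ b₀ p₀ hγ hγ1 hb hp1 hPP)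

/-! ### Profile monotonicity of the history tail (ym-vet-19936's observation `historyTailAt_mono_profile`, re-proved here so the skeleton is self-contained) -/

/-- `θBal` is monotone in the profile `(b₀, p₀)` for `0 < γ ≤ 1`, `1 ≤ L` (`g_i ≤ 1` ⇒ `1 + log g_i⁻¹ ≥ 1`). [cite: Balaban1985UV3, (7) p.257] -/
theorem θBal_mono_profile {L : ℕ} (hL : 1 ≤ L) {γ : ℝ} (hγ : 0 < γ) (hγ1 : γ ≤ 1) {b₀ b₀' p₀ p₀' : ℝ} (hb : 0 ≤ b₀)
    (hbb : b₀ ≤ b₀') (hpp : p₀ ≤ p₀') (i : ℕ) : θBal L γ b₀ p₀ i ≤ θBal L γ b₀' p₀' i := by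
  unfold θBal B10.pFun
  have hg := sqrt_coupling_pos_le hL hγ i
  have hg1 := coupling_le_one hL hγ hγ1 i
  set g : ℝ := Real.sqrt (γ * ((L : ℝ)⁻¹) ^ i)
  have hx1 : 1 ≤ 1 + Real.log g⁻¹ := by
    have : 0 ≤ Real.log g⁻¹ := Real.log_nonneg (one_le_inv_iff₀.mpr ⟨hg.1, hg1⟩)
    linarith
  have hpow : (1 + Real.log g⁻¹) ^ p₀ ≤ (1 + Real.log g⁻¹) ^ p₀' := Real.rpow_le_rpow_of_exponent_le hx1 hpp
  have hpow0 : 0 ≤ (1 + Real.log g⁻¹) ^ p₀' := Real.rpow_nonneg (zero_le_one.trans hx1) _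
  exact mul_le_mul_of_nonneg_left (mul_le_mul hbb hpow (Real.rpow_nonneg (zero_le_one.trans hx1) _) (hb.trans hbb)) hg.1.le

/-- `histGood` grows with the threshold profile. [cite: Balaban1985UV3, (7) p.257] -/
theorem histGood_mono {F : T3Family} {θ θ' : ℕ → ℝ} (hθ : ∀ i, θ i ≤ θ' i) (K n : ℕ) :
    histGood F ℰp θ K n ⊆ histGood F ℰp θ' K n :=
  fun _ hU j hj p => (hU j hj p).trans_le (hθ (K - j))

/-- **`HistoryTailAt` IS MONOTONE IN THE PROFILE** for `0 < γ ≤ 1`: a summable bound on the bad-history masses at `(b₀, p₀)` bounds them at every larger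
profile (the bad events shrink). [cite: Balaban1985UV3, (7) p.257 and (71) p.273] -/
theorem historyTailAt_mono_profile (F : T3Family) {γ : ℝ} (hγ : 0 < γ) (hγ1 : γ ≤ 1) {b₀ b₀' p₀ p₀' : ℝ} (hb : 0 ≤ b₀)
    (hbb : b₀ ≤ b₀') (hpp : p₀ ≤ p₀') {m : ℕ} (h : HistoryTailAt F γ b₀ p₀ m) : HistoryTailAt F γ b₀' p₀' m := by
  obtain ⟨w, hw, hK⟩ := h
  have hsub : ∀ K n, (histGood F ℰp (θBal F.L γ b₀' p₀') K n)ᶜ ⊆ (histGood F ℰp (θBal F.L γ b₀ p₀) K n)ᶜ := fun K n =>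
    Set.compl_subset_compl.mpr (histGood_mono (fun i => θBal_mono_profile F.hL.2.le hγ hγ1 hb hbb hpp i) K n)
  refine ⟨w, hw, fun K => ?_⟩
  haveI := isProbabilityMeasure_gibbsK F ℰp hγ.le K
  haveI := isProbabilityMeasure_gibbsK F ℰp hγ.le (K + 1)
  exact ⟨(measureReal_mono (hsub K (K / m)) (measure_ne_top _ _)).trans (hK K).1,
    (measureReal_mono (hsub (K + 1) (K / m)) (measure_ne_top _ _)).trans (hK K).2⟩

/-- **`HistoryTailL ⇐ stub_jointRateHigh ∧ stub_perPlaquetteSmallBlocks`** (+ the LANDED chessboard, budget, split, tail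
and `historyTailAt_of_averagedTailAt`): one profile per block size from `historyTailAt_oneProfile`, raised above the thresholds `(b₁, p₁)` by
`historyTailAt_mono_profile` (`γ₁ ≤ 1`); block sizes outside the `T3Family` range are vacuous.  Concludes the ROUTE DECL by name. -/
theorem HistoryTailL_of : Summit.QuantumFields.YangMills.Theses.UnitScaleTilt.HistoryTailL := by
  intro L b₁ p₁
  by_cases hL : Odd L ∧ 1 < L
  · obtain ⟨b₀, p₀, γ₁, hb, hp2, hγ₁, hγ₁1, h⟩ := historyTailAt_oneProfile L hL.1 hL.2
    refine ⟨max b₁ b₀, max p₁ p₀, le_max_left _ _, le_max_left _ _, hb.trans_le (le_max_right _ _),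
      hp2.trans_le (le_max_right _ _), fun m hm => ⟨γ₁, hγ₁, fun F γ hFL hγ hle => ?_⟩⟩
    exact historyTailAt_mono_profile F hγ (hle.trans hγ₁1) hb.le (le_max_right _ _) (le_max_right _ _)
      (h m hm F γ hFL hγ hle)
  · refine ⟨max b₁ 1, max p₁ 3, le_max_left _ _, le_max_left _ _, lt_of_lt_of_le one_pos (le_max_right _ _),
      lt_of_lt_of_le (by norm_num) (le_max_right _ _), fun m _ => ⟨1, one_pos, fun F γ hFL _ _ => ?_⟩⟩
    have hF := F.hL
    rw [hFL] at hF
    exact (hL hF).elim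

end Summit.QuantumFields.YangMills.Cruxes.HistoryTailL.BirthV5q

end
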